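import Literature.NumberTheory.EllipticCurves.ComplexMultiplicationBurungaleFlachFiniteLeavesProofs
import Literature.NumberTheory.EllipticCurves.ComplexMultiplicationBurungaleFlachDescentDeuringProofs
import Literature.NumberTheory.EllipticCurves.ComplexMultiplicationSingularModuliProofs
import Literature.NumberTheory.EllipticCurves.ComplexMultiplicationLFunctionIsogenyHoldsProofs
import Literature.NumberTheory.EllipticCurves.AnalyticRankEntireValueProofs
import HarnessLib

/-!
# bsd.S28 (Burungale–Flach): the finiteness half of Theorem 1.1 over the CM field from three
leaves — Coates–Wiles 1977 §6, Rubin 1987 §10, Deuring — and the `Ш` part of bsd.S28 without any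
continuation leaf

Seventh proof file of `Literature.NumberTheory.EllipticCurves.ComplexMultiplication` for
**bsd.S28**; sibling of `ComplexMultiplicationBurungaleFlachFiniteLeavesProofs.lean` (D-0014
append protocol: a new file, everything proved, no definitions, no named fact introduced or
restated). It concerns the named fact

* `Literature.NumberTheory.EllipticCurves.BurungaleFlach2024_finite_primary_cmField` —
  Burungale–Flach, Camb. J. Math. 12 (2024), Prop. 4.1, last assertion (arXiv p. 19), as used in
  the proof of Thm. 1.1 (p. 22), at `F = K`: for a CM curve `E/ℚ` with
  `j(E) ∈ maximalCMJInvariants`, `L(E/ℚ, 1) ≠ 0`, `K` its CM field and `W'` a globally minimal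
  model of `E_K`, the groups `W'(K) = E(K)` and `Ш(E_K/K)[p^∞]` are finite for every prime `p`
  (Remark 10 of the paper: Coates–Wiles 1977, Arthaud 1978, Rubin 1981; Rubin 1987 for `Ш`),

whose census stood (sibling files `…FiniteLeavesProofs`, `…DescentLeavesProofs`) at four named
facts: Coates–Wiles finiteness over `ℚ` (by now a consequence of the single `𝔭`-adic fact
`CoatesWiles1977_L_one_div_period_mem_prime`, §6 of the 1977 paper, everything else on its pages
being proved: `finite_point_of_j_mem_maximalCMJInvariants_of_L_one_ne_zero_of_pAdicDivisibility`),
Rubin 1987 §10 (`Rubin1987_sha_primary_finite`), Deuring's `L(E_K/K, s) = L(E/ℚ, s)²`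
(`Deuring_LFunction_baseChange_cmField`) and the **Deuring–Hecke continuation** of `L(E/ℚ, s)`
(`hasEntireLFunction_of_j_mem_maximalCMJInvariants`, Silverman *Advanced Topics* II Cor. 10.5.1),
the last one entering at exactly one point: to read Rubin's hypothesis `L(E_K/K, 1) ≠ 0` off
`L(E/ℚ, 1) ≠ 0` and Deuring's formal identity one wanted `W.entireLFunction` to be a genuine
continuation (`entireLFunction_one_eq_sq_of_LFunction_eq_mul_self`).

**That continuation leaf is logically redundant.** By
`entireLFunction_one_ne_zero_of_LFunction_eq_mul_self` (`AnalyticRankEntireValueProofs`, proved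
for every pair of Weierstrass curves with `W'.LFunction = W.LFunction²`): `L(W, 1) ≠ 0` implies
`L(W', 1) = L(W, 1)² ≠ 0` in the tree's sense *with no continuation hypothesis* (if `L(W, s)` has
no entire continuation, the tree's `L(W, 1)` is the series `∑ aₙ n⁻¹` itself, and `≠ 0` forces
its absolute convergence, from which the value `L(W', 1)` is computed directly). Hence:

* `BurungaleFlach2024_finite_primary_cmField_of_classical_leaves` (**proved**): the fact from
  Coates–Wiles finiteness over `ℚ` (`finite_point_of_j_mem_maximalCMJInvariants_of_L_one_ne_zero`),
  Rubin 1987 §10 and Deuring — the sibling's `…_of_Deuring` (`…DescentLeavesProofs`) without `hH`;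
* `BurungaleFlach2024_finite_primary_cmField_of_three_leaves` (**proved**, the census): the fact
  follows, sorry-free, from exactly **three** named facts, all from the theory of complex
  multiplication and all used by the paper itself (Remark 10; Lemma 13):
  1. `CoatesWiles1977_L_one_div_period_mem_prime` — Coates–Wiles, Invent. Math. 39 (1977), §6
     (Thm. 29, Cor. 32, Thm. 34, Lemma 35: `𝔭 ∣ Ω⁻¹L(E/ℚ, 1)` for the good split non-anomalous
     `p > 7` when `E(ℚ)` is infinite);
  2. `Rubin1987_sha_primary_finite` — Rubin, Invent. Math. 89 (1987), §10 (`Ш(E_K/K)[p^∞]`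
     finite for every `p` when `L(E_K/K, 1) ≠ 0`);
  3. `Deuring_LFunction_baseChange_cmField` — Deuring, `L(E_K/K, s) = L(E/ℚ, s)²` (Silverman,
     *Advanced Topics*, II Thm. 10.5 (a), (b));
* `finite_point_baseChange_cmField_of_pAdicDivisibility` (**proved**): the Mordell–Weil half
  alone — `E(K)` finite — rests on leaf 1 only (the twist `E^{(d_K)}` has the same `L`-value by the
  proved CM isogeny `isIsogenous_quadraticTwist_cmFieldDiscr_holds` and the proved Knapp 11.67,
  `entireLFunction_eq_of_isIsogenous'`);
* `shaFinite_of_j_mem_maximalCMJInvariants_of_L_one_ne_zero_of_thmA_of_Deuring`,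
  `shaFinite_of_hasCM_of_L_one_ne_zero_of_thmA_of_Deuring`,
  `shaFinite_of_hasCM_of_L_one_ne_zero_of_level8` (**proved**): the same surgery on the `Ш` part
  of bsd.S28 (`shaFinite_of_hasCM_of_L_one_ne_zero`, Rubin 1987 §0 Remark (3)): level 7
  (`ComplexMultiplicationShaHeckeProofs`) minus its continuation leaf — the fact now rests on
  Rubin's Thm. 6.6 and §10 for `E_K`, Deuring, and the `only if` half of the classification of
  rational CM `j`-invariants.

Discharged since the sibling was written, and used here as theorems: Knapp 11.67
(`LFunction_eq_of_isIsogenous_holds`), the nine singular moduli and the CM period lattice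
(`singularModuli_classNumberOne_holds`, `exists_isCMPeriod_of_j_mem_maximalCMJInvariants_holds`),
Deuring's `a_p = π + π̄` (`Deuring1941_frobeniusTrace_eq_add_conj_holds`), the six CM twist
isogenies, Mordell–Weil.

**Triage of `BurungaleFlach2024_finite_primary_cmField_holds` (SIZE XL, unchanged).** Leaves 1
and 2 are the `𝔭`-adic theories of Coates–Wiles (elliptic units, the explicit reciprocity law,
§§2–6) and Rubin (Euler system of elliptic units, §§1–10); leaf 3 is being reduced prime by prime
in `ComplexMultiplicationDeuringLocal*.lean` / `…DeuringRamifiedProofs.lean` and follows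
alternatively from Artin formalism for quadratic base change
(`Deuring_LFunction_baseChange_cmField_of_artinFormalism`). The unconditional theorem is not
asserted here.

## Design

`open WeierstrassCurve` is issued at file scope, *before* `namespace Literature.NumberTheory.EllipticCurves`:
the import closure now contains declarations `Literature.NumberTheory.EllipticCurves.WeierstrassCurve.Affine.*`,
so inside the namespace a bare `open WeierstrassCurve` would open that shadow namespace instead of
Mathlib's (cf. `CONVENTIONS.md` §2 on shadowed root namespaces).

## References

* A. Burungale, M. Flach, *The conjecture of Birch and Swinnerton-Dyer for certain elliptic curves
  with complex multiplication*, Camb. J. Math. 12 (2024), no. 2 (arXiv:2206.09874): Thm. 1.1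
  (p. 3), Prop. 4.1 and Remark 10 (p. 19), proof of Thm. 1.1 (p. 22). [BurungaleFlach2024]
* J. Coates, A. Wiles, *On the conjecture of Birch and Swinnerton-Dyer*, Invent. Math. 39 (1977),
  Thm. 1 (p. 223), §6 (pp. 250–251). [CoatesWiles1977]
* K. Rubin, *Tate–Shafarevich groups and L-functions of elliptic curves with complex
  multiplication*, Invent. Math. 89 (1987), Thm. A and (0.1) (p. 527), §0 Remark (3) (p. 528),
  Thm. 6.6, §10 (pp. 548–549). [Rubin1987Sha]
* J. H. Silverman, *Advanced Topics in the Arithmetic of Elliptic Curves*, GTM 151 (1994), Ch. II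
  Thm. 10.5 and Cor. 10.5.1. [SilvermanATAEC1994]
-/

noncomputable section

open scoped Classical

open WeierstrassCurve NumberField

namespace Literature.NumberTheory.EllipticCurves

/-! ### The finiteness half of Theorem 1.1 over `K` without the continuation leaf -/

/-- **Burungale–Flach 2024, Prop. 4.1 (finiteness half) at `F = K`, from Coates–Wiles finiteness
over `ℚ`, Rubin 1987 §10 and Deuring — no continuation hypothesis** (Remark 10 of the paper:
*"the finiteness of the Mordell–Weil group is due to Coates and Wiles, Arthaud and Rubin. For
`L = K` the finiteness of the Tate–Shafarevich group is due to Rubin [rubin87]"*). Same proof as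
`BurungaleFlach2024_finite_primary_cmField_of_Deuring` (`…DescentLeavesProofs.lean`): `E(ℚ)`
finite (`hF1`); `E^{(d_K)}(ℚ)` finite (`hF1` for the twist, which has the same `j` and, by
Deuring's identity, the same `L`-value, `entireLFunction_quadraticTwist_eq_of_Deuring`); hence
`E(K)` finite (`finite_point_baseChange_of_finite_of_finite_quadraticTwist`); `Ш(E_K/K)[p^∞]`
finite by Rubin 1987 §10 (`hR`), whose hypothesis `L(E_K/K, 1) ≠ 0` is now obtained from
`L(E/ℚ, 1) ≠ 0` and Deuring's formal identity (`hD`) by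
`entireLFunction_one_ne_zero_of_LFunction_eq_mul_self`, unconditionally; both statements
transported to the globally minimal model `W' = C • E_K`.
[cite: BurungaleFlach2024, Prop. 4.1 with Remark 10 (arXiv p. 19)]
[cite: CoatesWiles1977, Thm 1 (p. 223)] [cite: Rubin1987Sha, §10, proof of Thm. A, p. 549]
[cite: SilvermanATAEC1994, Ch. II Thm. 10.5 (a), (b)] -/
theorem BurungaleFlach2024_finite_primary_cmField_of_classical_leaves
    (hF1 : finite_point_of_j_mem_maximalCMJInvariants_of_L_one_ne_zero)
    (hR : Rubin1987_sha_primary_finite) (hD : Deuring_LFunction_baseChange_cmField) :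
    BurungaleFlach2024_finite_primary_cmField := by
  intro W _ hj hL K _ _ hK W' _ _ hW' p hp
  obtain ⟨C, rfl⟩ := hW'
  -- the square-root generator of the CM field: `θ² = d_K`, `θ ∉ ℚ`
  obtain ⟨θ, hθ', hc⟩ := hK.exists_sqrt hj
  have hd0 : (cmFieldDiscr W.j : ℚ) ≠ 0 :=
    QuadraticFields.Quadratic.sq_ne_zero_of_not_mem_range hθ' hc
  -- `E(ℚ)` and `E^{(d_K)}(ℚ)` are finite (Coates–Wiles, for `E` and for its twist)
  have hfinQ : Finite W.toAffine.Point := hF1 W hj hL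
  haveI : (W.quadraticTwist (cmFieldDiscr W.j : ℚ)).IsElliptic := W.isElliptic_quadraticTwist hd0
  have hjd : (W.quadraticTwist (cmFieldDiscr W.j : ℚ)).j ∈ maximalCMJInvariants := by
    rw [W.j_quadraticTwist hd0]
    exact hj
  have hLd : (W.quadraticTwist (cmFieldDiscr W.j : ℚ)).entireLFunction 1 ≠ 0 := by
    rw [entireLFunction_quadraticTwist_eq_of_Deuring hD W hj K hK hθ' hc]
    exact hL
  have hfinQd : Finite (W.quadraticTwist (cmFieldDiscr W.j : ℚ)).toAffine.Point :=
    hF1 (W.quadraticTwist (cmFieldDiscr W.j : ℚ)) hjd hLd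
  -- hence `E(K)` is finite, and so is `W'(K) ≅ E(K)`
  have hfinK : Finite (W.baseChange K).toAffine.Point :=
    W.finite_point_baseChange_of_finite_of_finite_quadraticTwist hK.1 hθ' hc hfinQ hfinQd
  have hfinW' : Finite (C • W.baseChange K).toAffine.Point :=
    Finite.of_equiv _ (VariableChange.pointEquiv (W.baseChange K) C).toEquiv
  -- `L(E_K/K, 1) = L(E/ℚ, 1)² ≠ 0` unconditionally, so Rubin 1987 §10 applies to `E_K`
  have hLK : (W.baseChange K).entireLFunction 1 ≠ 0 :=
    entireLFunction_one_ne_zero_of_LFunction_eq_mul_self (hD W hj K hK) hL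
  have hprim : Set.Finite {c : (W.baseChange K).sha | ∃ j : ℕ, p ^ j • c = 0} :=
    hR W hj K hK hLK p hp
  exact ⟨hfinW', ((W.baseChange K).finite_sha_primary_variableChange_iff C p).mpr hprim⟩

/-- **Census: the finiteness half of Burungale–Flach's Theorem 1.1 at `F = K` rests on exactly
three printed statements of the theory of complex multiplication.**
`BurungaleFlach2024_finite_primary_cmField` follows, sorry-free, from the `𝔭`-divisibility of
`Ω⁻¹L(E/ℚ, 1)` of Coates–Wiles 1977, §6 (`h1`), Rubin 1987, §10 for `E_K` (`hR`) and Deuring's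
`L(E_K/K, s) = L(E/ℚ, s)²` (`hD`); the Mordell–Weil theorem, uniformisation and the nine singular
moduli behind `Λ_E = Ω𝓞_K`, the closing argument of Coates–Wiles (pp. 225, 232, 250–251)
(`finite_point_of_j_mem_maximalCMJInvariants_of_L_one_ne_zero_of_pAdicDivisibility`), the
quadratic descent of finiteness, the invariance of both statements under changes of variables
over `K` and the passage `L(E/ℚ, 1) ≠ 0 ⇒ L(E_K/K, 1) ≠ 0` being theorems of the tree. Compared
with `BurungaleFlach2024_finite_primary_cmField_of_leaves` (five leaves): Knapp 11.67 is a
theorem (and no longer used), and the Deuring–Hecke continuation is not needed. This is Remark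
10 of the paper made precise for `F = L = K`.
[cite: BurungaleFlach2024, Prop. 4.1 with Remark 10 (arXiv p. 19) and proof of Thm. 1.1 (p. 22)]
[cite: CoatesWiles1977, Thm 1 (p. 223); §6 pp. 250–251] [cite: Rubin1987Sha, §10, p. 549]
[cite: SilvermanATAEC1994, Ch. II Thm. 10.5 (a), (b)] -/
theorem BurungaleFlach2024_finite_primary_cmField_of_three_leaves
    (h1 : CoatesWiles1977_L_one_div_period_mem_prime) (hR : Rubin1987_sha_primary_finite)
    (hD : Deuring_LFunction_baseChange_cmField) : BurungaleFlach2024_finite_primary_cmField :=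
  BurungaleFlach2024_finite_primary_cmField_of_classical_leaves
    (finite_point_of_j_mem_maximalCMJInvariants_of_L_one_ne_zero_of_pAdicDivisibility h1) hR hD

/-- Bookkeeping: the three leaves are among the five of
`BurungaleFlach2024_finite_primary_cmField_of_leaves` (Coates–Wiles Thm. 1 being derived from its
`𝔭`-adic core, `CoatesWiles1977_L_one_eq_zero_of_not_isOfFinAddOrder_of_pAdicDivisibility`), so
the new census refines the old trust base and trades nothing in.
[cite: BurungaleFlach2024, Prop. 4.1 with Remark 10 (arXiv p. 19)] -/
theorem BurungaleFlach2024_finite_primary_cmField_of_three_leaves_of_five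
    (h1 : CoatesWiles1977_L_one_div_period_mem_prime) (hR : Rubin1987_sha_primary_finite)
    (hKn : LFunction_eq_of_isIsogenous) (hD : Deuring_LFunction_baseChange_cmField)
    (hH : hasEntireLFunction_of_j_mem_maximalCMJInvariants) :
    BurungaleFlach2024_finite_primary_cmField :=
  BurungaleFlach2024_finite_primary_cmField_of_leaves
    (CoatesWiles1977_L_one_eq_zero_of_not_isOfFinAddOrder_of_pAdicDivisibility h1) hR hKn hD hH

/-! ### The Mordell–Weil half over `K` from the `𝔭`-adic core of Coates–Wiles alone -/

/-- **`E(K)` is finite, from Coates–Wiles 1977 §6 alone.** For `E/ℚ` with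
`j(E) ∈ maximalCMJInvariants`, `L(E/ℚ, 1) ≠ 0` and `K` its CM field, the Mordell–Weil group
`E(K)` is finite, assuming only the `𝔭`-divisibility fact
`CoatesWiles1977_L_one_div_period_mem_prime` (`h1`): `E(ℚ)` is finite
(`finite_point_of_j_mem_maximalCMJInvariants_of_L_one_ne_zero_of_pAdicDivisibility`), the twist
`E^{(d_K)}` is `ℚ`-isogenous to `E` (`isIsogenous_quadraticTwist_cmFieldDiscr_holds`) so has the
same `L`-value (Knapp 11.67 / Faltings, `entireLFunction_eq_of_isIsogenous'`, a theorem) and the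
same `j`, hence `E^{(d_K)}(ℚ)` is finite too, and `E(K)` is finite by the quadratic descent
(`finite_point_baseChange_of_finite_of_finite_quadraticTwist`; Burungale–Flach Remark 10:
Coates–Wiles, Arthaud). [cite: CoatesWiles1977, Thm 1 (p. 223); §6 pp. 250–251]
[cite: BurungaleFlach2024, Remark 10 (arXiv p. 19)] -/
theorem finite_point_baseChange_cmField_of_pAdicDivisibility
    (h1 : CoatesWiles1977_L_one_div_period_mem_prime) (W : WeierstrassCurve ℚ) [W.IsElliptic]
    (hj : W.j ∈ maximalCMJInvariants) (hL : W.entireLFunction 1 ≠ 0)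
    (K : Type) [Field K] [NumberField K] (hK : IsCMFieldOfJ K W.j) :
    Finite (W.baseChange K).toAffine.Point := by
  have hF1 := finite_point_of_j_mem_maximalCMJInvariants_of_L_one_ne_zero_of_pAdicDivisibility h1
  obtain ⟨θ, hθ', hc⟩ := hK.exists_sqrt hj
  have hd0 : (cmFieldDiscr W.j : ℚ) ≠ 0 :=
    QuadraticFields.Quadratic.sq_ne_zero_of_not_mem_range hθ' hc
  haveI : (W.quadraticTwist (cmFieldDiscr W.j : ℚ)).IsElliptic := W.isElliptic_quadraticTwist hd0
  have hjd : (W.quadraticTwist (cmFieldDiscr W.j : ℚ)).j ∈ maximalCMJInvariants := by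
    rw [W.j_quadraticTwist hd0]
    exact hj
  have hLd : (W.quadraticTwist (cmFieldDiscr W.j : ℚ)).entireLFunction 1 ≠ 0 := by
    rw [← entireLFunction_eq_of_isIsogenous' (isIsogenous_quadraticTwist_cmFieldDiscr_holds W hj)]
    exact hL
  exact W.finite_point_baseChange_of_finite_of_finite_quadraticTwist hK.1 hθ' hc (hF1 W hj hL)
    (hF1 (W.quadraticTwist (cmFieldDiscr W.j : ℚ)) hjd hLd)

/-! ### The `Ш` part of bsd.S28 without the continuation leaf -/

/-- **Remark (3) from Theorem A, maximal-order case, from Theorem A and Deuring only** (Rubin,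
Invent. Math. 89 (1987), p. 528: *"Theorem A implies the analogous statement over `ℚ`"*). For
`E/ℚ` with `j(E) ∈ maximalCMJInvariants` and `L(E/ℚ, 1) ≠ 0`: realise the CM field as a number
field `K` (`exists_isCMFieldOfJ`); `L(E_K/K, 1) ≠ 0` by Deuring's formal identity (`hD`) and
`entireLFunction_one_ne_zero_of_LFunction_eq_mul_self` (no continuation hypothesis); hence
`Ш(E_K/K)` is finite by Theorem A (`hA`), and `Ш(E/ℚ)` is finite because `Ш(E/ℚ) → Ш(E_K/K)`
has finite kernel (`shaFinite_of_baseChange`). Level 1 / level 7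
(`…_of_facts`, `…_of_thmA_of_hecke`) with the continuation leaf removed.
[cite: Rubin1987Sha, §0 Remark (3) (p. 528), Thm. A and (0.1) (p. 527)]
[cite: SilvermanATAEC1994, Ch. II Thm. 10.5 (a), (b)] -/
theorem shaFinite_of_j_mem_maximalCMJInvariants_of_L_one_ne_zero_of_thmA_of_Deuring
    (hA : Rubin1987_shaFinite_baseChange_cmField) (hD : Deuring_LFunction_baseChange_cmField) :
    shaFinite_of_j_mem_maximalCMJInvariants_of_L_one_ne_zero := by
  intro W _ hj hL
  obtain ⟨K, _, _, hK⟩ := exists_isCMFieldOfJ hj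
  exact shaFinite_of_baseChange W K
    (hA W hj K hK (entireLFunction_one_ne_zero_of_LFunction_eq_mul_self (hD W hj K hK) hL))

/-- **bsd.S28 (`Ш` part) from Rubin's Theorem A, Deuring and the `only if` half of the
classification** — neither modularity nor the Deuring–Hecke continuation. The maximal-order case
is the previous theorem; the passage from CM by an arbitrary order to CM by `𝓞_K` over `ℚ` is
level 6's `shaFinite_of_hasCM_of_L_one_ne_zero_of_maximalOrder_of_j_mem_cmJInvariants_of_hasCM`.
[cite: Rubin1987Sha, Thm. A (p. 527), §0 Remark (3) (p. 528) and §10 (p. 548)] -/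
theorem shaFinite_of_hasCM_of_L_one_ne_zero_of_thmA_of_Deuring
    (hA : Rubin1987_shaFinite_baseChange_cmField) (hD : Deuring_LFunction_baseChange_cmField)
    (h₁ : j_mem_cmJInvariants_of_hasCM) : shaFinite_of_hasCM_of_L_one_ne_zero :=
  shaFinite_of_hasCM_of_L_one_ne_zero_of_maximalOrder_of_j_mem_cmJInvariants_of_hasCM
    (shaFinite_of_j_mem_maximalCMJInvariants_of_L_one_ne_zero_of_thmA_of_Deuring hA hD) h₁

/-- **bsd.S28 (`Ш` part), level 8 — the census.** `shaFinite_of_hasCM_of_L_one_ne_zero`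
(`E/ℚ` with CM and `L(E/ℚ, 1) ≠ 0 ⇒ Ш(E/ℚ)` finite; Rubin 1987, §0 Remark (3)) follows,
sorry-free, from four named facts: Rubin 1987, Thm. 6.6 for `E_K` (`h66`,
`Rubin1987_sha_torsionBy_eq_bot_cofinite`), Rubin 1987, §10 (`h10`,
`Rubin1987_sha_primary_finite`), Deuring's `L(E_K/K, s) = L(E/ℚ, s)²` (`hD`) and the `only if`
half of the classification of rational CM `j`-invariants (`h₁`, `j_mem_cmJInvariants_of_hasCM`) —
level 7 (`shaFinite_of_hasCM_of_L_one_ne_zero_of_level7`) without its continuation leaf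
`hasEntireLFunction_of_j_mem_maximalCMJInvariants`.
[cite: Rubin1987Sha, Thm. A, §0 Remark (3), Thm. 6.6 and §10]
[cite: SilvermanATAEC1994, Ch. II Thm. 10.5 (a), (b)] -/
theorem shaFinite_of_hasCM_of_L_one_ne_zero_of_level8
    (h66 : Rubin1987_sha_torsionBy_eq_bot_cofinite) (h10 : Rubin1987_sha_primary_finite)
    (hD : Deuring_LFunction_baseChange_cmField) (h₁ : j_mem_cmJInvariants_of_hasCM) :
    shaFinite_of_hasCM_of_L_one_ne_zero :=
  shaFinite_of_hasCM_of_L_one_ne_zero_of_thmA_of_Deuring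
    (Rubin1987_shaFinite_baseChange_cmField_of_level2 h66 h10) hD h₁

end Literature.NumberTheory.EllipticCurves

end
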